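import Summits.ResolutionOfSingularities.KangarooAtlas.MizutaniVectorGroup
import HarnessLib

/-!
# Mizutani's conjecture — "`B` is a vector group iff its exponent is `0`" (Mizutani Rem. 1.2), the converse direction

Cell topic `Summits/ResolutionOfSingularities/KangarooAtlas` (pub-rosobs); namespace
`Summit.ResolutionOfSingularities.KangarooAtlas.Mizutani`.  AI-written; *AI review is weaker than expert review*; NOT a
resolution theorem, NOT summit progress.  `MizutaniVectorGroup.lean` proves `exponent 0 ⇒ IsVectorGroup` (Hironaka's `U_+(𝔭)S` is
generated by linear forms).  Here the converse, through DIMENSIONS: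

* `span_bIdeal_inter_one_eq` — the linear forms of `U_+(𝔭)S` are exactly the linear forms of `𝔭` (= Oda's level `0`, `invForms k p 𝔭 0`);
* `ringKrullDim_quotient_bIdeal_of_isVectorGroup` — for a vector group, `dim B_{P,𝔭} = (n+1) − dim_k (L_B)_0 = hsDimAt 𝔭 0` (no hypothesis);
* `finrank_hirForms_eq_of_isVectorGroup` [hH] — then `U(𝔭) ∩ L` has all levels of the same dimension (Hironaka's exponent is `0`);
* **`exponentLE_zero_of_isVectorGroup`** [hH, hOda] and **`isVectorGroup_iff_exponentLE_zero`** [hH, hOda] — Mizutani's Remark 1.2 as an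
  equivalence between Hironaka's `IsVectorGroup` and Oda's `ExponentLE 0`, conditional on Hironaka's generation theorem (`hH`) and Oda's
  equality `U(𝔭) ∩ L_e = (L_B)_e` (`hOda`).

References: [Mizutani1973HironakaGroupSchemes] Rem. 1.2 (p. 86), Thm. 1.3; [Oda1983HironakaGroupSchemeII] §2 (p. 1168).
-/

open MvPolynomial Literature.AlgebraicGeometry.Resolution Literature.AlgebraicGeometry.Resolution.HironakaScheme
  Literature.RingTheory.MvPolynomial

namespace Summit.ResolutionOfSingularities.KangarooAtlas.Mizutani

universe u

section Converse

variable (k : Type u) [Field k] (p : ℕ) [hp : Fact p.Prime] [CharP k p] {n : ℕ}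
  (𝔭 : Ideal (MvPolynomial (Fin (n + 1)) k))

omit hp [CharP k p] in
/-- The additive form of level `0` is the linear form: `addForm 0 a = Σ a_j X_j = linForm a`. [folklore] -/
theorem addForm_zero_eq_linForm (a : Fin (n + 1) → k) : addForm k p 0 a = linForm a := by
  rw [addForm_eq_powForm, pow_zero, ← expand_linForm, expand_one_apply]

/-- **The linear forms of `U_+(𝔭)S` are the linear forms of `𝔭`**: the ideal they generate is the level-`0` ideal of Oda's family.
[cite: Mizutani1973HironakaGroupSchemes, Def. 1.1 (U_1(p) = S_1 ∩ p)] -/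
theorem span_bIdeal_inter_one_eq [𝔭.IsPrime] :
    Ideal.span ((bIdeal k 𝔭 : Set (MvPolynomial (Fin (n + 1)) k)) ∩
        (homogeneousSubmodule (Fin (n + 1)) k 1 : Set (MvPolynomial (Fin (n + 1)) k))) =
      Ideal.span (linForm '' (invForms k p 𝔭 0 : Set (Fin (n + 1) → k))) := by
  refine le_antisymm (Ideal.span_mono ?_) (Ideal.span_mono ?_)
  · rintro f ⟨hfB, hf1⟩
    have hf1' : f ∈ LinearMap.range (linForm (K := k) (n := n + 1)) := by
      rw [range_linForm]; exact hf1
    obtain ⟨v, rfl⟩ := hf1'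
    refine ⟨v, ?_, rfl⟩
    rw [SetLike.mem_coe, mem_invForms_zero_iff, addForm_zero_eq_linForm]
    exact bIdeal_le hfB
  · rintro _ ⟨v, hv, rfl⟩
    refine ⟨?_, ?_⟩
    · rw [SetLike.mem_coe, ← addForm_zero_eq_linForm k p]
      have hv' : v ∈ hirForms k p 𝔭 0 := by rw [hirForms_zero]; exact hv
      exact famIdeal_hirForms_le_bIdeal k p 𝔭
        (Ideal.subset_span (Set.mem_iUnion.mpr ⟨0, v, hv', rfl⟩))
    · rw [SetLike.mem_coe, ← range_linForm]
      exact LinearMap.mem_range_self _ v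

/-- **For a vector group, `dim B_{P,𝔭} = (n+1) − dim_k (L_B)_0 = hsDimAt 𝔭 0`** (no hypothesis: `U_+(𝔭)S` is generated by the linear forms of
`𝔭`, a linear subspace). [cite: Mizutani1973HironakaGroupSchemes, Rem. 1.2 and Thm. 1.3] -/
theorem ringKrullDim_quotient_bIdeal_of_isVectorGroup [𝔭.IsPrime] (hV : IsVectorGroup k 𝔭) :
    ringKrullDim (MvPolynomial (Fin (n + 1)) k ⧸ bIdeal k 𝔭) = (hsDimAt k p 𝔭 0 : WithBot ℕ∞) := by
  unfold IsVectorGroup at hV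
  rw [hV, span_bIdeal_inter_one_eq k p 𝔭, ringKrullDim_quotient_span_linForm]
  rfl

/-- The dimensions `dim_k (U(𝔭) ∩ L)_e` are non-decreasing in `e`. [cite: Mizutani1973HironakaGroupSchemes, §1 (a), (c)] -/
theorem finrank_hirForms_mono [𝔭.IsPrime] (e m : ℕ) :
    Module.finrank k (hirForms k p 𝔭 e) ≤ Module.finrank k (hirForms k p 𝔭 (e + m)) := by
  rw [← finrank_span_frobVec_image k p m (hirForms k p 𝔭 e)]
  exact Submodule.finrank_mono (span_frobVec_image_hirForms_le m e)

/-- **A vector group has Hironaka-exponent `0`**: all levels of `U(𝔭) ∩ L` have the dimension of level `0` (conditional on Hironaka's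
generation theorem `hH`). [cite: Mizutani1973HironakaGroupSchemes, Rem. 1.2 (p. 86: "B is a vector group if and only if the exponent of B equals 0")] -/
theorem finrank_hirForms_eq_of_isVectorGroup [𝔭.IsPrime] (hH : Hironaka1970_thm1_cor.{u} p) (hP : IsPoint k 𝔭)
    (hV : IsVectorGroup k 𝔭) (j : ℕ) :
    Module.finrank k (hirForms k p 𝔭 j) = Module.finrank k (hirForms k p 𝔭 0) := by
  obtain ⟨e₁, he₁⟩ := exists_eventually_eq_span_hirForms k p 𝔭
  have hB := ringKrullDim_quotient_bIdeal k p 𝔭 hH hP (e₀ := e₁) (fun j hj => (he₁ j hj).le)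
  rw [ringKrullDim_quotient_bIdeal_of_isVectorGroup k p 𝔭 hV] at hB
  unfold hsDimAt at hB
  have hB' : n + 1 - Module.finrank k (invForms k p 𝔭 0) = n + 1 - Module.finrank k (hirForms k p 𝔭 e₁) := by
    exact_mod_cast hB
  rw [← hirForms_zero 𝔭] at hB'
  have hle0 := Submodule.finrank_le (hirForms k p 𝔭 0)
  have hle1 := Submodule.finrank_le (hirForms k p 𝔭 e₁)
  rw [Module.finrank_pi, Fintype.card_fin] at hle0 hle1
  have h01 : Module.finrank k (hirForms k p 𝔭 e₁) = Module.finrank k (hirForms k p 𝔭 0) := by omega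
  -- squeeze level `j` between level `0` and level `j + e₁ ≥ e₁`
  have hj1 : Module.finrank k (hirForms k p 𝔭 j) ≤ Module.finrank k (hirForms k p 𝔭 (j + e₁)) :=
    finrank_hirForms_mono k p 𝔭 j e₁
  have hj2 : Module.finrank k (hirForms k p 𝔭 (j + e₁)) = Module.finrank k (hirForms k p 𝔭 e₁) := by
    rw [he₁ (j + e₁) (Nat.le_add_left _ _), finrank_span_frobVec_image]
  have hj0 : Module.finrank k (hirForms k p 𝔭 0) ≤ Module.finrank k (hirForms k p 𝔭 j) := by
    have := finrank_hirForms_mono k p 𝔭 0 j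
    rwa [Nat.zero_add] at this
  omega

/-- **A vector group (Hironaka) has exponent `0` (Oda)**, conditional on `hH` and Oda's equality `hOda`: from
`dim B_{P,𝔭} = hsDimAt 𝔭 0` (vector group) and `dim B_{P,𝔭} = hsDim 𝔭 = hsDimAt 𝔭 (exponent)` the level-`0` and exponent-level dimensions
of `L_B` agree, which forces `ExponentLE 0`. [cite: Mizutani1973HironakaGroupSchemes, Rem. 1.2 (p. 86)] -/
theorem exponentLE_zero_of_isVectorGroup [𝔭.IsPrime] (hH : Hironaka1970_thm1_cor.{u} p)
    (hOda : ∀ e, hirForms k p 𝔭 e = invForms k p 𝔭 e) (hP : IsPoint k 𝔭) (hV : IsVectorGroup k 𝔭) :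
    ExponentLE k p 𝔭 0 := by
  have hB := ringKrullDim_quotient_bIdeal_eq_hsDim k p 𝔭 hH hOda hP
  rw [ringKrullDim_quotient_bIdeal_of_isVectorGroup k p 𝔭 hV] at hB
  have hB' : hsDimAt k p 𝔭 0 = hsDim k p 𝔭 := by exact_mod_cast hB
  unfold hsDim hsDimAt at hB'
  have hle0 := finrank_invForms_le k p 𝔭 0
  have hleE := finrank_invForms_le k p 𝔭 (exponent k p 𝔭)
  have h0E : Module.finrank k (invForms k p 𝔭 0) = Module.finrank k (invForms k p 𝔭 (exponent k p 𝔭)) := by omega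
  refine exponentLE_of_finrank_le k p 𝔭 fun j _ => ?_
  rcases le_or_gt j (exponent k p 𝔭) with hj | hj
  · obtain ⟨m, hm⟩ := Nat.exists_eq_add_of_le hj
    have := finrank_invForms_mono k p 𝔭 j m
    rw [← hm] at this
    omega
  · have hdim := hsDimAt_eq_of_exponentLE k p 𝔭 (exponentLE_exponent k p 𝔭) hj.le
    unfold hsDimAt at hdim
    have hlej := finrank_invForms_le k p 𝔭 j
    omega

/-- **MIZUTANI'S REMARK 1.2 as an equivalence**: `B_{P,𝔭}` is a vector group (Hironaka: `U_+(𝔭)S` generated by linear forms) iff its exponent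
is `0` (Oda: `(L_B)_j = k·F^j(L_B)_0` for all `j`) — conditional on Hironaka's generation theorem and Oda's equality.
[cite: Mizutani1973HironakaGroupSchemes, Rem. 1.2 (p. 86)] -/
theorem isVectorGroup_iff_exponentLE_zero [𝔭.IsPrime] (hH : Hironaka1970_thm1_cor.{u} p)
    (hOda : ∀ e, hirForms k p 𝔭 e = invForms k p 𝔭 e) (hP : IsPoint k 𝔭) :
    IsVectorGroup k 𝔭 ↔ ExponentLE k p 𝔭 0 :=
  ⟨fun hV => exponentLE_zero_of_isVectorGroup k p 𝔭 hH hOda hP hV, fun h0 => isVectorGroup_of_exponentLE_zero' k p 𝔭 hH hP h0⟩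

/-- The same with `exponent k p 𝔭 = 0`. [cite: Mizutani1973HironakaGroupSchemes, Rem. 1.2 (p. 86)] -/
theorem isVectorGroup_iff_exponent_eq_zero [𝔭.IsPrime] (hH : Hironaka1970_thm1_cor.{u} p)
    (hOda : ∀ e, hirForms k p 𝔭 e = invForms k p 𝔭 e) (hP : IsPoint k 𝔭) :
    IsVectorGroup k 𝔭 ↔ exponent k p 𝔭 = 0 := by
  rw [isVectorGroup_iff_exponentLE_zero k p 𝔭 hH hOda hP, ← Nat.le_zero, exponent_le_iff]

end Converse

end Summit.ResolutionOfSingularities.KangarooAtlas.Mizutani
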